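import Mathlib

/-!
# LangWeilTransfer, support item `TameResolution` (stmt-ValiantsHypothesis-6378) — envelope
# arithmetic (single-exponential bookkeeping)

Route `LangWeilTransfer` of `ValiantsHypothesis` (conditional route; honest framing: bookkeeping,
nothing here bears on VP ≠ VNP, which is NOT proved). Step (4c) of the Noether-free quantitative
assembly of `TameResolution` (val-width-6373-p2 g2): the closed-form degree and weight bounds of
the quantitative pass are products, powers, sums and factorials of quantities of two currencies,

* DEGREE currency `x ≤ B ^ i` (`B = (d+2)^(m+1) ≥ 2`),
* WEIGHT currency `x ≤ 2 ^ (B ^ i * L)` (`L = log₂ w + log₂ t + 2 ≥ 1`),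

and this file provides the closure rules of the two currencies (the exponent `i` only ever grows
additively), the conversions (a degree is a weight; `w, t ≤ 2^L`; `d + 1, m + 1, (d+1)^n ≤ B`),
and the final read-out in the shape of `TameResolution` (`x ≤ (d+2)^(a(m+1))`,
`Nat.log 2 x ≤ (d+2)^(a(m+1)) · L^a`). Elementary arithmetic only.
-/

-- the summit and the problem share the name `ValiantsHypothesis` (D-0017 single-conjunct layout)
set_option linter.dupNamespace false

namespace Summit.ValiantsHypothesis.ValiantsHypothesis.Theorems.LangWeilTransfer

namespace Envelope

variable {B L x y i j k : ℕ}

/-! ## Degree currency `x ≤ B ^ i` -/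

/-- `k ≤ B^k` for `B ≥ 2`. -/
theorem self_le_pow (hB : 2 ≤ B) (k : ℕ) : k ≤ B ^ k :=
  (Nat.lt_two_pow_self).le.trans (Nat.pow_le_pow_left hB k)

/-- Monotonicity in the exponent. -/
theorem dmono (hB : 2 ≤ B) (hx : x ≤ B ^ i) (hij : i ≤ j) : x ≤ B ^ j :=
  hx.trans (Nat.pow_le_pow_right (by omega) hij)

/-- Products add exponents. -/
theorem dmul (hx : x ≤ B ^ i) (hy : y ≤ B ^ j) : x * y ≤ B ^ (i + j) := by
  rw [pow_add]; exact Nat.mul_le_mul hx hy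

/-- Sums: `x + y ≤ 2 B^(i+j) ≤ B^(i+j+1)`. -/
theorem dadd (hB : 2 ≤ B) (hx : x ≤ B ^ i) (hy : y ≤ B ^ j) : x + y ≤ B ^ (i + j + 1) := by
  have hi : B ^ i ≤ B ^ (i + j) := Nat.pow_le_pow_right (by omega) (by omega)
  have hj : B ^ j ≤ B ^ (i + j) := Nat.pow_le_pow_right (by omega) (by omega)
  calc x + y ≤ B ^ (i + j) + B ^ (i + j) := Nat.add_le_add (hx.trans hi) (hy.trans hj)
    _ = 2 * B ^ (i + j) := by ring
    _ ≤ B * B ^ (i + j) := Nat.mul_le_mul_right _ hB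
    _ = B ^ (i + j + 1) := by ring

/-- Powers with exponent `k ≤ j` multiply exponents. -/
theorem dpow (hB : 2 ≤ B) (hx : x ≤ B ^ i) (hk : k ≤ j) : x ^ k ≤ B ^ (i * j) :=
  (Nat.pow_le_pow_left hx k).trans (by rw [← pow_mul]; exact Nat.pow_le_pow_right (by omega) (Nat.mul_le_mul_left _ hk))

/-! ## Weight currency `x ≤ 2 ^ (B ^ i * L)` -/

/-- Monotonicity in the exponent. -/
theorem wmono (hx : x ≤ 2 ^ (B ^ i * L)) (hB : 2 ≤ B) (hij : i ≤ j) : x ≤ 2 ^ (B ^ j * L) :=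
  hx.trans (Nat.pow_le_pow_right (by omega) (Nat.mul_le_mul_right _ (Nat.pow_le_pow_right (by omega) hij)))

/-- A degree is a weight: `x ≤ B^i ≤ 2^(B^i) ≤ 2^(B^i L)`. -/
theorem wofd (hL : 1 ≤ L) (hx : x ≤ B ^ i) : x ≤ 2 ^ (B ^ i * L) :=
  (hx.trans (Nat.lt_two_pow_self).le).trans (Nat.pow_le_pow_right (by omega) (Nat.le_mul_of_pos_right _ hL))

/-- Products. -/
theorem wmul (hB : 2 ≤ B) (hx : x ≤ 2 ^ (B ^ i * L)) (hy : y ≤ 2 ^ (B ^ j * L)) :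
    x * y ≤ 2 ^ (B ^ (i + j + 1) * L) := by
  refine (Nat.mul_le_mul hx hy).trans ?_
  rw [← pow_add, ← add_mul]
  exact Nat.pow_le_pow_right (by omega) (Nat.mul_le_mul_right _ (dadd hB le_rfl le_rfl))

/-- Powers with exponent in the degree currency. -/
theorem wpow (hx : x ≤ 2 ^ (B ^ i * L)) (hk : k ≤ B ^ j) : x ^ k ≤ 2 ^ (B ^ (i + j) * L) := by
  refine (Nat.pow_le_pow_left hx k).trans ?_
  rw [← pow_mul]
  refine Nat.pow_le_pow_right (by omega) ?_
  calc B ^ i * L * k = B ^ i * k * L := by ring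
    _ ≤ B ^ i * B ^ j * L := Nat.mul_le_mul_right _ (Nat.mul_le_mul_left _ hk)
    _ = B ^ (i + j) * L := by rw [pow_add]

/-- Sums. -/
theorem wadd (hB : 2 ≤ B) (hL : 1 ≤ L) (hx : x ≤ 2 ^ (B ^ i * L)) (hy : y ≤ 2 ^ (B ^ j * L)) :
    x + y ≤ 2 ^ (B ^ (i + j + 1) * L) := by
  have hi : 2 ^ (B ^ i * L) ≤ 2 ^ (B ^ (i + j) * L) :=
    Nat.pow_le_pow_right (by omega) (Nat.mul_le_mul_right _ (Nat.pow_le_pow_right (by omega) (by omega)))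
  have hj : 2 ^ (B ^ j * L) ≤ 2 ^ (B ^ (i + j) * L) :=
    Nat.pow_le_pow_right (by omega) (Nat.mul_le_mul_right _ (Nat.pow_le_pow_right (by omega) (by omega)))
  have h2 : x + y ≤ 2 ^ (B ^ (i + j) * L + 1) := by rw [pow_succ]; omega
  refine h2.trans (Nat.pow_le_pow_right (by omega) ?_)
  have hpos : 1 ≤ B ^ (i + j) * L := Nat.le_trans hL (Nat.le_mul_of_pos_left _ (Nat.pos_of_ne_zero (by positivity)))
  calc B ^ (i + j) * L + 1 ≤ B ^ (i + j) * L * 2 := by omega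
    _ ≤ B ^ (i + j) * L * B := Nat.mul_le_mul_left _ hB
    _ = B ^ (i + j + 1) * L := by ring

/-- Factorials: `k! ≤ k^k`. -/
theorem wfact (hL : 1 ≤ L) (hk : k ≤ B ^ j) : k.factorial ≤ 2 ^ (B ^ (j + j) * L) :=
  (Nat.factorial_le_pow k).trans (wpow (wofd hL hk) hk)

/-- `1 ≤ 2^(…)`. -/
theorem wone : 1 ≤ 2 ^ (B ^ i * L) := Nat.one_le_two_pow

/-! ## Conversions of the raw parameters -/

/-- `2 ≤ B = (d+2)^(m+1)`. -/
theorem two_le_base (d m : ℕ) : 2 ≤ (d + 2) ^ (m + 1) :=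
  le_trans (by omega : 2 ≤ d + 2) (Nat.le_self_pow (by omega) _)

/-- `d + 1 ≤ B`. -/
theorem succ_le_base (d m : ℕ) : d + 1 ≤ ((d + 2) ^ (m + 1)) ^ 1 := by
  rw [pow_one]; exact le_trans (by omega : d + 1 ≤ d + 2) (Nat.le_self_pow (by omega) _)

/-- `(d+1)^n ≤ B` for `n ≤ m + 1`. -/
theorem pow_le_base {d m n : ℕ} (hn : n ≤ m + 1) : (d + 1) ^ n ≤ ((d + 2) ^ (m + 1)) ^ 1 := by
  rw [pow_one]
  exact (Nat.pow_le_pow_left (by omega) n).trans (Nat.pow_le_pow_right (by omega) hn)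

/-- `c ≤ B ^ c` for the structural constants (`n, r, m + 1, 2, …`), given `c ≤ m + 1` or outright. -/
theorem le_base_of_le {d m c : ℕ} (hc : c ≤ m + 1) : c ≤ ((d + 2) ^ (m + 1)) ^ 1 := by
  rw [pow_one]
  exact hc.trans ((Nat.lt_pow_self (by omega : 1 < d + 2)).le)

/-- `w ≤ 2 ^ L` with `L = log₂ w + log₂ t + 2` (in the weight currency with exponent `0`). -/
theorem w_le (w t : ℕ) {B : ℕ} : w ≤ 2 ^ (B ^ 0 * (Nat.log 2 w + Nat.log 2 t + 2)) := by
  rw [pow_zero, one_mul]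
  exact (Nat.lt_pow_succ_log_self (by norm_num : 1 < 2) w).le.trans (Nat.pow_le_pow_right (by omega) (by omega))

/-- `t ≤ 2 ^ L`. -/
theorem t_le (w t : ℕ) {B : ℕ} : t ≤ 2 ^ (B ^ 0 * (Nat.log 2 w + Nat.log 2 t + 2)) := by
  rw [pow_zero, one_mul]
  exact (Nat.lt_pow_succ_log_self (by norm_num : 1 < 2) t).le.trans (Nat.pow_le_pow_right (by omega) (by omega))

/-! ## Read-out in the shape of `TameResolution` -/

/-- Degrees: `x ≤ B^i`, `i ≤ a` gives `x ≤ (d+2)^(a(m+1))`. -/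
theorem final_degree {d m a : ℕ} (hx : x ≤ ((d + 2) ^ (m + 1)) ^ i) (hi : i ≤ a) :
    x ≤ (d + 2) ^ (a * (m + 1)) := by
  refine hx.trans ?_
  rw [← pow_mul, mul_comm]
  exact Nat.pow_le_pow_right (by omega) (Nat.mul_le_mul_right _ hi)

/-- Weights: `x ≤ 2^(B^i L)`, `i ≤ a`, `1 ≤ a` gives `Nat.log 2 x ≤ (d+2)^(a(m+1)) · L^a`. -/
theorem final_weight {d m a : ℕ} (hx : x ≤ 2 ^ (((d + 2) ^ (m + 1)) ^ i * L)) (hi : i ≤ a) (ha : 1 ≤ a)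
    (hL : 1 ≤ L) : Nat.log 2 x ≤ (d + 2) ^ (a * (m + 1)) * L ^ a := by
  have h1 : Nat.log 2 x ≤ ((d + 2) ^ (m + 1)) ^ i * L := by
    have := Nat.log_mono_right (b := 2) hx
    rwa [Nat.log_pow (by norm_num)] at this
  refine h1.trans (Nat.mul_le_mul ?_ ?_)
  · rw [← pow_mul, mul_comm]
    exact Nat.pow_le_pow_right (by omega) (Nat.mul_le_mul_right _ hi)
  · calc L = L ^ 1 := (pow_one L).symm
      _ ≤ L ^ a := Nat.pow_le_pow_right hL ha

end Envelope

end Summit.ValiantsHypothesis.ValiantsHypothesis.Theorems.LangWeilTransfer
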